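/-
Copyright (c) 2026. All rights reserved.
Released under Apache 2.0 license as described in the file LICENSE.
Authors: HodgeCM publication cell (pub-hodgecm), GR lane, seat GR-2 (`pub-hodgecm-own-hyp34`).
-/
import Literature.NumberTheory.Weil1964.ArchLeviSectionQuotient
import Literature.NumberTheory.Weil1964.ArchGaussianOrbit
import Literature.NumberTheory.Automorphic.UnitaryGroupArchRealPair
import HarnessLib

/-!
# Folland's quotient character on the Levi section: `quot (m(a)) = sign (det a)`

Sequel of `ArchLeviSectionQuotient` (`MpS.quot_leviGL_of_det_pos`: the Levi element `|det a|^{-1/2} f ∘ a⁻¹` of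
`Mp^𝓢(ℝ^σ)` is metaplectic when `det a > 0`).  Here the other component of `GL_σ(ℝ)`:

* `hermitePi_zero_comp_orthogonal`, `leviGL_apply_hermitePi_zero_of_orthogonal`, `vac_leviGL_of_orthogonal` — an
  ORTHOGONAL `r` acts on `𝓢(ℝ^σ)` by `f ↦ f ∘ rᵀ` and fixes the Gaussian vacuum, so `C(m(r)) = 1`;
* `follandP_proj_leviGL_of_orthogonal`, **`quot_leviGL_of_orthogonal : quot (m(r)) = det r`** (Folland's block
  `P(m(r, r)) = r`);
* the reflection `reflGL i₀` (`det = −1`), and **`quot_leviGL_of_det_neg : quot (m(a)) = −1` for `det a < 0`**,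
  **`quot_leviGL_eq_ite : quot (m(a)) = if 0 < det a then 1 else −1`** (`quot` is multiplicative, Folland Thm. (4.37));
  `quot_leviAlong_eq_ite` for the conjugated Levi sections `leviAlong x A`;
* §3 at a real place `v` of `F` SPLIT in the quadratic extension `E`: the archimedean Weil section
  `archSectionRealSplit` (`UnitaryGroupArchRealPair`) has **`quot = sign det g_w`** (`quot_archSectionRealSplit`), `g_w`
  the `w`-component — the sign that the twist of the type-(ii) places of [GelbartRogawski1991, Prop. 3.1.1] must absorb
  (over `ℝ` the Weil index `γ(det a)` is `1` or `±i`: [Kudla1994, §3, case `E = F ⊕ F`]).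

Topic `NumberTheory/Weil1964`; KERNEL only: one definition (`reflGL`) and theorems; no `def … : Prop`, no named fact,
no `sorry`.  Written for the stage-1 cell `pub-hodgecm` (GR lane); nothing here is a claim of the manuscripts
adjudicated by that cell.

## References
* G. B. Folland, *Harmonic Analysis in Phase Space* (1989), §4.1 (4.16), §4.2 (4.24), Thm. (4.37) [Folland1989].
* J. Adams, *The theta correspondence over ℝ* (2007), §5 Rem. 5.6 [Adams2007].
* S. S. Kudla, Israel J. Math. 87 (1994), §3 [Kudla1994].
-/

set_option autoImplicit false

noncomputable section

open scoped Matrix ComplexConjugate Classical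
open Matrix Complex NumberField NumberField.InfinitePlace NumberField.mixedEmbedding
open Literature.RepresentationTheory.HeisenbergGroup
open Literature.RepresentationTheory.HeisenbergGroup.SymplecticMatrix
open Literature.Analysis.SegalBargmann
open Literature.NumberTheory.Automorphic Literature.NumberTheory.Automorphic.UnitaryGroup

namespace Literature.NumberTheory.Weil1964

/-! ## §1 Orthogonal Levi elements: `C = 1`, `P = r`, `quot = det r` -/

section Orthogonal

variable {σ : Type*} [Fintype σ] [DecidableEq σ]

/-- **the Gaussian vacuum is invariant under orthogonal substitutions**: `h₀ (r x) = h₀ (x)` for `rᵀ r = 1`.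
[cite: Folland1989, §1.7, §4.5 (4.62)] -/
theorem hermitePi_zero_comp_orthogonal (r : Matrix σ σ ℝ) (hr : rᵀ * r = 1) (x : σ → ℝ) :
    hermitePi (0 : σ →₀ ℕ) (r *ᵥ x) = hermitePi (0 : σ →₀ ℕ) x := by
  rw [hermitePi_zero_eq_smul_gaussS, _root_.smul_apply, _root_.smul_apply,
    gaussS_apply I_smul_one_mem_siegelH, gaussS_apply I_smul_one_mem_siegelH, gaussFun_apply, gaussFun_apply]
  have hc : cvec (r *ᵥ x) = (r.map Complex.ofRealHom) *ᵥ cvec x := by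
    ext k
    rw [cvec_apply]
    exact RingHom.map_mulVec Complex.ofRealHom r x k
  have hRR : (r.map Complex.ofRealHom)ᵀ * r.map Complex.ofRealHom = 1 := by
    rw [← Matrix.transpose_map, ← Matrix.map_mul, hr, Matrix.map_one _ (map_zero _) (map_one _)]
  have hdot : cvec (r *ᵥ x) ⬝ᵥ ((I • (1 : Matrix σ σ ℂ)) *ᵥ cvec (r *ᵥ x)) = cvec x ⬝ᵥ ((I • (1 : Matrix σ σ ℂ)) *ᵥ cvec x) := by
    rw [Matrix.smul_mulVec, Matrix.one_mulVec, Matrix.smul_mulVec, Matrix.one_mulVec, dotProduct_smul,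
      dotProduct_smul, hc, Matrix.dotProduct_mulVec, ← Matrix.mulVec_transpose, Matrix.mulVec_mulVec, hRR,
      Matrix.one_mulVec]
  rw [hdot]

/-- `|det r| = 1` for an orthogonal `r`. [cite: Folland1989, §4.2 Prop. (4.39)] -/
theorem abs_det_eq_one_of_orthogonal (r : Matrix σ σ ℝ) (hr : rᵀ * r = 1) : |r.det| = 1 := by
  have h : r.det * r.det = 1 := by
    have h' := congrArg Matrix.det hr
    rwa [Matrix.det_mul, Matrix.det_transpose, Matrix.det_one] at h'
  have h2 : |r.det| ^ 2 = 1 := by rw [sq_abs, sq, h]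
  exact (pow_eq_one_iff_of_nonneg (abs_nonneg _) two_ne_zero).1 h2

/-- **the Levi element of an orthogonal `r` fixes the vacuum**: `m(r) h₀ = |det r|^{-1/2} h₀ ∘ r⁻¹ = h₀`.
[cite: Folland1989, §4.2 (4.24)] -/
theorem leviGL_apply_hermitePi_zero_of_orthogonal (r : GL σ ℝ) (hr : (r : Matrix σ σ ℝ)ᵀ * (r : Matrix σ σ ℝ) = 1) :
    (MpS.leviGL r).1.2 (hermitePi 0) = hermitePi 0 := by
  ext x
  rw [MpS.leviGL_apply_snd, leviS_apply, glEquiv_symm_apply]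
  have hdet : LinearMap.det ((glEquiv r : (σ → ℝ) ≃ₗ[ℝ] (σ → ℝ)) : (σ → ℝ) →ₗ[ℝ] (σ → ℝ)) = (r : Matrix σ σ ℝ).det := by
    rw [coe_glEquiv_eq_toLin', LinearMap.det_toLin']
  have hinv : ((r⁻¹ : GL σ ℝ) : Matrix σ σ ℝ) = (r : Matrix σ σ ℝ)ᵀ := by
    rw [Matrix.coe_units_inv, Matrix.inv_eq_left_inv hr]
  have hrT : ((r : Matrix σ σ ℝ)ᵀ)ᵀ * (r : Matrix σ σ ℝ)ᵀ = 1 := by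
    rw [Matrix.transpose_transpose]
    exact mul_eq_one_comm.1 hr
  rw [leviFactor, hdet, abs_det_eq_one_of_orthogonal _ hr, Real.one_rpow, Complex.ofReal_one, one_mul, hinv,
    hermitePi_zero_comp_orthogonal _ hrT]

/-- `C(m(r)) = 1` for an orthogonal `r`. [cite: Folland1989, §4.2 (4.36)] -/
theorem vac_leviGL_of_orthogonal (r : GL σ ℝ) (hr : (r : Matrix σ σ ℝ)ᵀ * (r : Matrix σ σ ℝ) = 1) :
    MpS.vac (MpS.leviGL r) = 1 := by
  rw [MpS.vac_apply, leviGL_apply_hermitePi_zero_of_orthogonal r hr, toL2_hermitePi_zero, inner_self_eq_norm_sq_to_K,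
    norm_vacL2]
  norm_num

omit [DecidableEq σ] in
/-- the matrix of `glEquiv a` is `a`. [cite: Folland1989, §4.2 (4.24)] -/
theorem toMatrix'_glEquiv [DecidableEq σ] (a : GL σ ℝ) :
    LinearMap.toMatrix' ((glEquiv a : (σ → ℝ) ≃ₗ[ℝ] (σ → ℝ)) : (σ → ℝ) →ₗ[ℝ] (σ → ℝ)) = (a : Matrix σ σ ℝ) := by
  rw [coe_glEquiv_eq_toLin', LinearMap.toMatrix'_toLin']

/-- **Folland's block `P` of an orthogonal Levi element is `r`**: `P(m(r, (r⁻¹)ᵀ)) = ½(r + r) = r`.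
[cite: Folland1989, §4.1 (4.16), §4.2 (4.24)] -/
theorem follandP_proj_leviGL_of_orthogonal (r : GL σ ℝ) (hr : (r : Matrix σ σ ℝ)ᵀ * (r : Matrix σ σ ℝ) = 1) :
    Sp.follandP (MpS.proj (MpS.leviGL r)) = (r : Matrix σ σ ℝ).map Complex.ofRealHom := by
  have hinv : ((trInv r : GL σ ℝ) : Matrix σ σ ℝ) = (r : Matrix σ σ ℝ) := by
    rw [coe_trInv, Matrix.coe_units_inv, Matrix.inv_eq_left_inv hr, Matrix.transpose_transpose]
  have htr : (glEquiv (trInv r) : (σ → ℝ) ≃ₗ[ℝ] (σ → ℝ)) = glEquiv r :=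
    LinearEquiv.ext fun x => by rw [glEquiv_apply, glEquiv_apply, hinv]
  rw [MpS.proj_leviGL, Sp.follandP_leviSp]
  change (2 : ℂ)⁻¹ • Complex.ofRealHom.mapMatrix (LinearMap.toMatrix'
      (((glEquiv r : (σ → ℝ) ≃ₗ[ℝ] (σ → ℝ)) : (σ → ℝ) →ₗ[ℝ] (σ → ℝ)) +
        ((glEquiv (trInv r) : (σ → ℝ) ≃ₗ[ℝ] (σ → ℝ)) : (σ → ℝ) →ₗ[ℝ] (σ → ℝ)))) = _
  rw [htr, map_add, toMatrix'_glEquiv, RingHom.mapMatrix_apply, Matrix.map_add _ (map_add Complex.ofRealHom), ← two_smul ℂ, smul_smul,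
    inv_mul_cancel₀ (two_ne_zero' ℂ), one_smul]

/-- **`quot (m(r)) = det r` for an orthogonal `r`** (`C = 1`, `det P = det r`). [cite: Folland1989, §4.2 Thm. (4.37)] -/
theorem quot_leviGL_of_orthogonal (r : GL σ ℝ) (hr : (r : Matrix σ σ ℝ)ᵀ * (r : Matrix σ σ ℝ) = 1) :
    MpS.quot (MpS.leviGL r) = ((r : Matrix σ σ ℝ).det : ℂ) := by
  rw [MpS.quot, vac_leviGL_of_orthogonal r hr, one_pow, one_mul, follandP_proj_leviGL_of_orthogonal r hr,
    ← RingHom.mapMatrix_apply, ← RingHom.map_det]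
  rfl

/-! ## §2 The reflection, and `quot (m(a)) = sign (det a)` -/

omit [Fintype σ] in
/-- the diagonal sign vector of the reflection in the `i₀`-th coordinate squares to `1`. [folklore] -/
private theorem reflVec_mul_self (i₀ i : σ) :
    Function.update (1 : σ → ℝ) i₀ (-1) i * Function.update (1 : σ → ℝ) i₀ (-1) i = 1 := by
  rcases eq_or_ne i i₀ with h | h
  · rw [h, Function.update_self]; norm_num
  · rw [Function.update_of_ne h, Pi.one_apply, one_mul]

/-- the reflection matrix squares to `1`. [folklore] -/
private theorem reflMat_mul_self (i₀ : σ) :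
    Matrix.diagonal (Function.update (1 : σ → ℝ) i₀ (-1)) * Matrix.diagonal (Function.update (1 : σ → ℝ) i₀ (-1)) = 1 := by
  rw [Matrix.diagonal_mul_diagonal, ← Matrix.diagonal_one]
  exact congrArg Matrix.diagonal (funext (reflVec_mul_self i₀))

/-- **the reflection `diag(1, …, −1, …, 1) ∈ GL_σ(ℝ)`** in the `i₀`-th coordinate (a representative of the
non-identity component, `det = −1`). [cite: Adams2007, §5 Rem. 5.6] -/
def reflGL (i₀ : σ) : GL σ ℝ :=
  ⟨Matrix.diagonal (Function.update (1 : σ → ℝ) i₀ (-1)), Matrix.diagonal (Function.update (1 : σ → ℝ) i₀ (-1)),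
    reflMat_mul_self i₀, reflMat_mul_self i₀⟩

/-- its matrix. [cite: Adams2007, §5 Rem. 5.6] -/
@[simp] theorem coe_reflGL (i₀ : σ) :
    ((reflGL i₀ : GL σ ℝ) : Matrix σ σ ℝ) = Matrix.diagonal (Function.update (1 : σ → ℝ) i₀ (-1)) := rfl

/-- it is an involution. [cite: Adams2007, §5 Rem. 5.6] -/
theorem reflGL_mul_self (i₀ : σ) : reflGL i₀ * reflGL i₀ = 1 :=
  Units.ext (by rw [Units.val_mul, coe_reflGL, Units.val_one]; exact reflMat_mul_self i₀)

/-- it is orthogonal. [cite: Adams2007, §5 Rem. 5.6] -/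
theorem reflGL_orthogonal (i₀ : σ) :
    ((reflGL i₀ : GL σ ℝ) : Matrix σ σ ℝ)ᵀ * ((reflGL i₀ : GL σ ℝ) : Matrix σ σ ℝ) = 1 := by
  rw [coe_reflGL, Matrix.diagonal_transpose]
  exact reflMat_mul_self i₀

/-- `det = −1`. [cite: Adams2007, §5 Rem. 5.6] -/
theorem det_reflGL (i₀ : σ) : ((reflGL i₀ : GL σ ℝ) : Matrix σ σ ℝ).det = -1 := by
  rw [coe_reflGL, Matrix.det_diagonal, Finset.prod_update_of_mem (Finset.mem_univ i₀)]
  simp only [Pi.one_apply, Finset.prod_const_one, mul_one]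

/-- **`quot (m(a)) = −1` for `det a < 0`**: `a = r · (r a)` with `r` a reflection (`quot = det r = −1`) and
`det (r a) > 0` (`quot = 1`); `quot` is multiplicative. [cite: Folland1989, §4.2 Thm. (4.37); Adams2007, §5 Rem. 5.6] -/
theorem quot_leviGL_of_det_neg (a : GL σ ℝ) (ha : (a : Matrix σ σ ℝ).det < 0) : MpS.quot (MpS.leviGL a) = -1 := by
  haveI : Nonempty σ := by
    by_contra h
    rw [not_nonempty_iff] at h
    have h1 : (a : Matrix σ σ ℝ).det = 1 := Matrix.det_isEmpty
    linarith
  obtain ⟨i₀⟩ := (inferInstance : Nonempty σ)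
  have hra : a = reflGL i₀ * (reflGL i₀ * a) := by rw [← mul_assoc, reflGL_mul_self, one_mul]
  have hpos : 0 < (((reflGL i₀ * a : GL σ ℝ)) : Matrix σ σ ℝ).det := by
    rw [Units.val_mul, Matrix.det_mul, det_reflGL]
    linarith
  rw [hra, MpS.leviGL_mul, MpS.quot_mul, quot_leviGL_of_orthogonal _ (reflGL_orthogonal i₀),
    MpS.quot_leviGL_of_det_pos _ hpos, det_reflGL]
  norm_num

/-- **`quot (m(a)) = sign (det a)`**: `1` on the identity component of `GL_σ(ℝ)`, `−1` on the other.
[cite: Folland1989, §4.2 Thm. (4.37); Adams2007, §5 Rem. 5.6] -/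
theorem quot_leviGL_eq_ite (a : GL σ ℝ) :
    MpS.quot (MpS.leviGL a) = if 0 < (a : Matrix σ σ ℝ).det then 1 else -1 := by
  split_ifs with h
  · exact MpS.quot_leviGL_of_det_pos a h
  · have hne : (a : Matrix σ σ ℝ).det ≠ 0 := (Matrix.isUnits_det_units a).ne_zero
    exact quot_leviGL_of_det_neg a (lt_of_le_of_ne (not_lt.1 h) hne)

/-- the same for a conjugated Levi section `leviAlong x A` (`quot` is conjugation invariant).
[cite: Folland1989, §4.2 Thm. (4.37)] -/
theorem quot_leviAlong_eq_ite {G : Type*} [Group G] (x : MpS σ) (A : G →* GL σ ℝ) (g : G) :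
    MpS.quot (MpS.leviAlong x A g) = if 0 < ((A g : GL σ ℝ) : Matrix σ σ ℝ).det then 1 else -1 := by
  rw [MpS.leviAlong_apply, MpS.quot_conj, quot_leviGL_eq_ite]

end Orthogonal

/-! ## §3 At a real place of `F` split in `E`: `quot (archSectionRealSplit g) = sign det g_w` -/

section RealSplit

variable (F E : Type) [Field F] [Field E] [NumberField E] [Algebra F E] (c : E ≃ₐ[F] E) (N : ℕ)

omit [NumberField E] in
/-- **`quot (archSectionRealSplit … x g) = sign (det g_w)`**, `g_w = (g_{ij})_w ∈ GL_N(ℝ)` the `w`-component of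
`g ∈ U(J)(E ⊗ ℝ)` at a real place `w` of `E` moved by `c` — the sign the archimedean twist must absorb at the
type-(ii) places. [cite: Kudla1994, §3] [cite: Folland1989, §4.2 Thm. (4.37)] -/
theorem quot_archSectionRealSplit (hcc : c * c = 1) (w : {w : InfinitePlace E // IsReal w})
    (T : Matrix (Fin N) (Fin N) F) {J : Matrix (Fin N) (Fin N) E} (hJ : J = T.map (algebraMap F E)) {δ : E} (hδ : δ ≠ 0)
    (x : MpS (Fin N)) (g : arch F E c N J) :
    MpS.quot (archSectionRealSplit F E c N hcc w T hJ hδ x g) =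
      if 0 < ((((g : GL (Fin N) (mixedSpace E)) : Matrix (Fin N) (Fin N) (mixedSpace E))).map (evalR E w)).det
      then 1 else -1 := by
  have hplus : (((isQuadraticCoordinates_splitReal (embedding_of_isReal w.2 δ) (embedding_of_isReal_ne_zero E w hδ)).plusGL
      rfl (Fin N) (archAtRealSplit F E c N hcc w T hJ g : unitaryGroupOfForm _ _) : GL (Fin N) ℝ) : Matrix (Fin N) (Fin N) ℝ) =
      ((((g : GL (Fin N) (mixedSpace E)) : Matrix (Fin N) (Fin N) (mixedSpace E))).map (evalR E w)) :=
    Matrix.ext fun i j => coe_plusGL_archAtRealSplit F E c N hcc w T hJ hδ g i j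
  rw [archSectionRealSplit, MonoidHom.comp_apply, archSplitSection_apply, MpS.quot_conj, quot_leviGL_eq_ite]
  rw [hplus]

end RealSplit

end Literature.NumberTheory.Weil1964

end
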